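import Literature.AlgebraicGeometry.Motives.SeesawChartKernelReprTheta
import Literature.AlgebraicGeometry.Modules.GrothendieckComplexKernelReprNatural
import Literature.AlgebraicGeometry.Motives.SeesawChartRepr
import Literature.AlgebraicGeometry.Motives.SeesawChartDualKernelRepr
import Literature.AlgebraicGeometry.Modules.DetClassDual
import HarnessLib

/-!
# `H0KernelRepr X 𝓕 U` — the Grothendieck complex of the seesaw chart computes `H⁰(X_B, 𝓕_B)` after every base change,
# naturally (Mumford, *Abelian Varieties* §5, Lemmas 1–2, Cor. 2; Görtz–Wedhorn II, Cor. 23.135 / (23.28.5))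

**`h0KernelRepr_holds : H0KernelRepr X 𝓕 U`** (★ `Motives.SeesawChartRepr`, B-p01's statement, verbatim) for every rank-one
`𝓕` on `X × W` with `X` proper and geometrically integral over `ℂ`, `W` locally of finite type, `U ⊆ W` an affine open:
the two-term complex `dKX : K⁰ → K¹` of finitely generated projective `A = Γ(W, U)`-modules of
★ `Motives.SeesawChartKernelReprTheta` (B-p10's Grothendieck complex of `𝓕_A`, scalars restricted along `A ≅ Γ(Spec A, 𝒪)`)
represents `B ↦ H⁰(X_B, 𝓕_B)` naturally in the `A`-algebra `B`, the isomorphism being the adapter `thetaLin`.  The one new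
content here is the NATURALITY of `θ` along `A`-algebra maps `φ : B → C` (`thetaLin_natural`: `θ_C ∘ H⁰(φ) = (φ ⊗ 1) ∘ θ_B`),
assembled from step (i) `secModOfIso_H0map`, ★ `Modules.kernelReprEquiv_natural` (step (ii)) and ★ `RingIsoBaseChange.tau_symm_rTensor`
(step (iii)) by an explicit chain of `congrArg`/`Eq.trans` with syntactic junctions; `h0KernelRepr_of_naturality` packages the data
into the socket and `h0KernelRepr_holds` picks a finite affine Čech cover (`exists_affine_cechCover`); the dual twin
`dualKernelRepr_holds : DualKernelRepr X 𝓕 U h𝓕` follows at `𝓕^∨` through ★ `dualKernelRepr_of_h0KernelRepr_dual`.  Theorems only; the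
`Flat`/`UniversallyOpen`/noetherian instances B-p10's complex wants are introduced by `haveI` inside the proofs (from
`flat_hom_of_field`, `universallyOpen_hom_of_isProper`, `isNoetherianRing_ΓSpec_chart`, `isLocallyNoetherian_specTest_chart`).
Everything is proved; no named facts, no `sorry`. Cell `hodgecm-mathlib`, M13 node N1 (1b) — author B-p04 (g15)
(`N1k-KernelReprAdapter.v1` a316b242 § Assembly), cut for the tree by B-p20 (g8) (B-plan1 R149).
HC_CM is proved only modulo the 7 printed citations until rung 0 closes.

## References
* [MumfordAV1970] D. Mumford, *Abelian Varieties*, TIFR Studies in Mathematics 5 (1970), §5, Lemmas 1–2, Cor. 2 (pp. 46–50).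
* [GortzWedhorn2023] U. Görtz, T. Wedhorn, *Algebraic Geometry II: Cohomology of Schemes* (2023), Cor. 23.135 (p. 355), (23.28.5).
-/

set_option autoImplicit false

noncomputable section

set_option backward.isDefEq.respectTransparency false

open CategoryTheory CategoryTheory.Limits AlgebraicGeometry MonoidalCategory CartesianMonoidalCategory
  Opposite TopologicalSpace
open scoped TensorProduct

namespace Literature.AlgebraicGeometry.Motives

namespace SeesawSubscheme

open Literature.AlgebraicGeometry.Modules Literature.Algebra.Module.RingIsoBaseChange

section Assembly

variable (X : SchemeOver ℂ) {W : SchemeOver ℂ} (𝓕 : (X ⊗ W).left.Modules) (U : W.left.affineOpens)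
  [IsProper X.hom] [GeometricallyIntegral X.hom] [LocallyOfFiniteType W.hom] (h𝓕 : HasRank 𝓕 1)
  {n : ℕ} (𝓥 : Fin n → (X ⊗ specTest U Γ(W.left, U)).left.Opens)
  (hV : ∀ s : Finset (Fin n), s.Nonempty → IsAffineOpen (cechOpen 𝓥 s)) (hcov : ⨆ i, 𝓥 i = ⊤)

/-- **`H0KernelRepr` from the naturality of `θ`**: the data `K⁰ = K•⁰`, `K¹ = K•¹` (B-p10's Grothendieck complex of
`𝓕_A` on a finite affine cover of `X × Spec A`, scalars restricted to `A` along `ΓSpecIso`), `d = d⁰¹`,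
`θ_B = thetaLin`, packaged into B-p01's literal socket, GIVEN the naturality square of `θ` along `A`-algebra maps
(= B-p10 (g8)'s §4 `kernelReprEquiv` naturality + the `FBIso`/`pullSec` coherence + `tau_rTensor`).
[cite: MumfordAV1970, §5 (pp. 46–47)] [cite: GortzWedhorn2023, Cor. 23.135 (p. 355)] -/
theorem h0KernelRepr_of_naturality
    (hnat : ∀ (B C : Type) [CommRing B] [Algebra Γ(W.left, U) B] [CommRing C] [Algebra Γ(W.left, U) C]
      (φ : B →ₐ[Γ(W.left, U)] C) (s : H0 X 𝓕 U B),
      ((thetaLin X 𝓕 U h𝓕 𝓥 hV hcov C (H0map X 𝓕 U φ s) :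
          LinearMap.ker ((dKX X 𝓕 U h𝓕 𝓥 hV hcov).baseChange C)) : C ⊗[Γ(W.left, U)] (KX X 𝓕 U h𝓕 𝓥 hV hcov).X 0) =
        φ.toLinearMap.rTensor ((KX X 𝓕 U h𝓕 𝓥 hV hcov).X 0)
          ((thetaLin X 𝓕 U h𝓕 𝓥 hV hcov B s : LinearMap.ker ((dKX X 𝓕 U h𝓕 𝓥 hV hcov).baseChange B)) :
            B ⊗[Γ(W.left, U)] (KX X 𝓕 U h𝓕 𝓥 hV hcov).X 0)) :
    H0KernelRepr X 𝓕 U :=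
  ⟨(KX X 𝓕 U h𝓕 𝓥 hV hcov).X 0, (KX X 𝓕 U h𝓕 𝓥 hV hcov).X 1, inferInstance, inferInstance, inferInstance,
    inferInstance, finite_KX X 𝓕 U h𝓕 𝓥 hV hcov 0, projective_KX X 𝓕 U h𝓕 𝓥 hV hcov 0,
    finite_KX X 𝓕 U h𝓕 𝓥 hV hcov 1, projective_KX X 𝓕 U h𝓕 𝓥 hV hcov 1, dKX X 𝓕 U h𝓕 𝓥 hV hcov,
    fun B _ _ => thetaLin X 𝓕 U h𝓕 𝓥 hV hcov B, fun B C _ _ _ _ φ s => hnat B C φ s⟩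

set_option maxHeartbeats 800000 in
/-- **NATURALITY OF THE ADAPTER `θ`** along `A`-algebra maps `φ : B → C`: `θ_C ∘ H⁰(φ) = (φ ⊗ 1) ∘ θ_B`. Assembled
from step (i) `secModOfIso_H0map` (PART C coherence), B-p10 (g8)'s §5 `kernelReprEquiv_natural` (step (ii)) and
PART A `tau_symm_rTensor` (step (iii)), by an explicit chain of `congrArg`/`Eq.trans` whose junctions are syntactic.
[cite: MumfordAV1970, §5 (pp. 46–47)] [cite: GortzWedhorn2023, Cor. 23.135 (p. 355) and (23.28.5)] -/
theorem thetaLin_natural (B C : Type) [CommRing B] [Algebra Γ(W.left, U) B] [CommRing C] [Algebra Γ(W.left, U) C]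
    (φ : B →ₐ[Γ(W.left, U)] C) (s : H0 X 𝓕 U B) :
    ((thetaLin X 𝓕 U h𝓕 𝓥 hV hcov C (H0map X 𝓕 U φ s) :
        LinearMap.ker ((dKX X 𝓕 U h𝓕 𝓥 hV hcov).baseChange C)) : C ⊗[Γ(W.left, U)] (KX X 𝓕 U h𝓕 𝓥 hV hcov).X 0) =
      φ.toLinearMap.rTensor ((KX X 𝓕 U h𝓕 𝓥 hV hcov).X 0)
        ((thetaLin X 𝓕 U h𝓕 𝓥 hV hcov B s : LinearMap.ker ((dKX X 𝓕 U h𝓕 𝓥 hV hcov).baseChange B)) :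
          B ⊗[Γ(W.left, U)] (KX X 𝓕 U h𝓕 𝓥 hV hcov).X 0) := by
  haveI : Flat X.hom := flat_hom_of_field X
  haveI : UniversallyOpen X.hom := universallyOpen_hom_of_isProper X
  haveI := isNoetherianRing_ΓSpec_chart U
  haveI := isLocallyNoetherian_specTest_chart U
  letI := Modules.testAlgebra (specTest U Γ(W.left, U)) (jTest U B)
  letI := Modules.testAlgebra (specTest U Γ(W.left, U)) (jTest U C)
  -- (a) `θ` unfolded at `C` and at `B`
  have aC := congrArg (fun z : LinearMap.ker ((dKX X 𝓕 U h𝓕 𝓥 hV hcov).baseChange C) =>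
      (z : C ⊗[Γ(W.left, U)] (KX X 𝓕 U h𝓕 𝓥 hV hcov).X 0))
    ((congrFun (coe_thetaLin X 𝓕 U h𝓕 𝓥 hV hcov C) (H0map X 𝓕 U φ s)).trans
      (congrFun (coe_thetaAdd X 𝓕 U h𝓕 𝓥 hV hcov C) (H0map X 𝓕 U φ s)))
  have aB := congrArg (fun z : LinearMap.ker ((dKX X 𝓕 U h𝓕 𝓥 hV hcov).baseChange B) =>
      (z : B ⊗[Γ(W.left, U)] (KX X 𝓕 U h𝓕 𝓥 hV hcov).X 0))
    ((congrFun (coe_thetaLin X 𝓕 U h𝓕 𝓥 hV hcov B) s).trans (congrFun (coe_thetaAdd X 𝓕 U h𝓕 𝓥 hV hcov B) s))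
  -- (b) `kerTau⁻¹` on underlying tensors
  have bC := coe_kerTau_symm (eA := εR U Γ(W.left, U)) (eB := εR U C) (heB := εR_algebraMap U C)
    (smul_KX X 𝓕 U h𝓕 𝓥 hV hcov 0) (smul_KX X 𝓕 U h𝓕 𝓥 hV hcov 1) ((KX X 𝓕 U h𝓕 𝓥 hV hcov).d 0 1).hom
    (kernelReprEquiv X (specTest U Γ(W.left, U)) 𝓥 (FB X 𝓕 U Γ(W.left, U)) hV hcov
      (hasRank_FB X 𝓕 U h𝓕 Γ(W.left, U)) (jTest U C)
      (secModOfIso (baseToTotal X (specTest U C)) (FBIso X 𝓕 U (Algebra.ofId Γ(W.left, U) C)) (H0map X 𝓕 U φ s)))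
  have bB := coe_kerTau_symm (eA := εR U Γ(W.left, U)) (eB := εR U B) (heB := εR_algebraMap U B)
    (smul_KX X 𝓕 U h𝓕 𝓥 hV hcov 0) (smul_KX X 𝓕 U h𝓕 𝓥 hV hcov 1) ((KX X 𝓕 U h𝓕 𝓥 hV hcov).d 0 1).hom
    (kernelReprEquiv X (specTest U Γ(W.left, U)) 𝓥 (FB X 𝓕 U Γ(W.left, U)) hV hcov
      (hasRank_FB X 𝓕 U h𝓕 Γ(W.left, U)) (jTest U B)
      (secModOfIso (baseToTotal X (specTest U B)) (FBIso X 𝓕 U (Algebra.ofId Γ(W.left, U) B)) s))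
  -- (c) step (i) transported
  have cC := congrArg (fun w => (tau (εR U Γ(W.left, U)) (εR U C) (εR_algebraMap U C)
      (smul_KX X 𝓕 U h𝓕 𝓥 hV hcov 0)).symm
      ((kernelReprEquiv X (specTest U Γ(W.left, U)) 𝓥 (FB X 𝓕 U Γ(W.left, U)) hV hcov
        (hasRank_FB X 𝓕 U h𝓕 Γ(W.left, U)) (jTest U C) w : LinearMap.ker _) :
          Γ((specTest U C).left, (⊤ : (specTest U C).left.Opens)) ⊗[Γ((specTest U Γ(W.left, U)).left,
            (⊤ : (specTest U Γ(W.left, U)).left.Opens))] _))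
    (secModOfIso_H0map X 𝓕 U φ s)
  -- (d) B-p10 (g8)'s naturality of the kernel representation, transported by `τ_C⁻¹`
  have dd := congrArg (fun v => (tau (εR U Γ(W.left, U)) (εR U C) (εR_algebraMap U C)
      (smul_KX X 𝓕 U h𝓕 𝓥 hV hcov 0)).symm v)
    (kernelReprEquiv_natural X (specTest U Γ(W.left, U)) 𝓥 (FB X 𝓕 U Γ(W.left, U)) hV hcov
      (hasRank_FB X 𝓕 U h𝓕 Γ(W.left, U)) (jTest U B) (jTest U C) (specTestMap U φ) (specTestMap_comp_jTest U φ)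
      (secModOfIso (baseToTotal X (specTest U B)) (FBIso X 𝓕 U (Algebra.ofId Γ(W.left, U) B)) s))
  -- (e) `τ⁻¹` along `φ`
  have ee := tau_symm_rTensor (εR U Γ(W.left, U)) (εR U B) (εR_algebraMap U B) (smul_KX X 𝓕 U h𝓕 𝓥 hV hcov 0)
    (εR U C) (εR_algebraMap U C) φ
    (testAlgHom (specTest U Γ(W.left, U)) (jTest U B) (jTest U C) (specTestMap U φ) (specTestMap_comp_jTest U φ))
    (fun b => (εR_natural U φ b).trans (testAlgHom_apply (specTest U Γ(W.left, U)) (jTest U B) (jTest U C)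
      (specTestMap U φ) (specTestMap_comp_jTest U φ) (εR U B b)).symm)
    ((kernelReprEquiv X (specTest U Γ(W.left, U)) 𝓥 (FB X 𝓕 U Γ(W.left, U)) hV hcov
        (hasRank_FB X 𝓕 U h𝓕 Γ(W.left, U)) (jTest U B)
        (secModOfIso (baseToTotal X (specTest U B)) (FBIso X 𝓕 U (Algebra.ofId Γ(W.left, U) B)) s) :
          LinearMap.ker _) :
      Γ((specTest U B).left, (⊤ : (specTest U B).left.Opens)) ⊗[Γ((specTest U Γ(W.left, U)).left,
        (⊤ : (specTest U Γ(W.left, U)).left.Opens))] _)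
  exact aC.trans (bC.trans (cC.trans (dd.trans (ee.trans
    (congrArg (fun u => φ.toLinearMap.rTensor ((KX X 𝓕 U h𝓕 𝓥 hV hcov).X 0) u) (aB.trans bB).symm)))))

include h𝓕 in
/-- **SOCKET (1b) `H0KernelRepr X 𝓕 U` DISCHARGED** for every rank-one `𝓕` on `X × W` (`X` proper, geometrically
integral; `W` locally of finite type over `ℂ`; `U ⊆ W` affine open): the two-term complex `d : K⁰ → K¹` of finitely
generated projective `A = Γ(W, U)`-modules (B-p10 (g8)'s Grothendieck complex of `𝓕_A` over a finite affine cover of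
`X × Spec A`, scalars restricted along `A ≅ Γ(Spec A, 𝒪)`) represents `B ↦ H⁰(X_B, 𝓕_B)` naturally in the
`A`-algebra `B`. [cite: MumfordAV1970, §5 (pp. 46–47)] [cite: GortzWedhorn2023, Cor. 23.135 (p. 355) and (23.28.5)] -/
theorem h0KernelRepr_holds : H0KernelRepr X 𝓕 U := by
  haveI : Flat X.hom := flat_hom_of_field X
  haveI : UniversallyOpen X.hom := universallyOpen_hom_of_isProper X
  haveI := isNoetherianRing_ΓSpec_chart U
  haveI := isLocallyNoetherian_specTest_chart U
  obtain ⟨n, 𝓥, hV, hcov⟩ := exists_affine_cechCover X (specTest U Γ(W.left, U))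
  exact h0KernelRepr_of_naturality X 𝓕 U h𝓕 𝓥 hV hcov
    (fun B C _ _ _ _ φ s => thetaLin_natural X 𝓕 U h𝓕 𝓥 hV hcov B C φ s)

/-- **SOCKET (1b) `DualKernelRepr X 𝓕 U h𝓕` DISCHARGED** — the same statement for the dual sections
`Hom(𝓕_B|_⊤, 𝒪|_⊤)` (★ `Motives.SeesawChartRepr`), from `h0KernelRepr_holds` at the rank-one dual `𝓕^∨`
(★ `Modules.hasRank_dual`) through ★ `dualKernelRepr_of_h0KernelRepr_dual` (`Motives.SeesawChartDualKernelRepr`,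
B-p10 (g8)/(g9)). [cite: MumfordAV1970, §5 (pp. 46–47)] [cite: GortzWedhorn2023, Cor. 23.135 (p. 355) and (23.28.5)] -/
theorem dualKernelRepr_holds : DualKernelRepr X 𝓕 U h𝓕 :=
  dualKernelRepr_of_h0KernelRepr_dual X 𝓕 U h𝓕 (h0KernelRepr_holds X (Modules.dual 𝓕) U (hasRank_dual h𝓕))

end Assembly

end SeesawSubscheme

end Literature.AlgebraicGeometry.Motives

end
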